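import Literature.Analysis.OperatorTheory.Enflo2023.Basic
import HarnessLib

/-!
# Enflo 2023, v2 eq. (11): the limit step of the Main Construction

Source under adjudication: Per H. Enflo, *On the invariant subspace problem in Hilbert spaces*, arXiv:2305.15442 (v1
2023, v2 2024), bib key `Enflo2023` — a CLAIMED proof of the invariant subspace problem for operators on a separable
Hilbert space.  This file is part of the kernel-tight typing of the manuscript by the b2b-enflo repair cell
(formaliser 2, Part B: (28)–(47), the limiting argument and the final deduction).  It records what FOLLOWS (proved
implications from the manuscript's displayed hypotheses) and, where a step does not follow, the typed inference
together with its refutation.  NOTHING here asserts that the manuscript's main theorem holds; no declaration concludes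
the invariant subspace problem for an arbitrary operator.  Value (BLOCK-2b): theorems / refutations of typed
inferences about a text — not progress on the problem.

EnfloISP — Part B (formaliser 2).  v2 eq. (11), p.4: the LIMIT STEP of the Main Construction.
Paper: "In the Main Construction (MC) … we have a sequence (y'_n) such that 0.7 > ε > 0.3, ε = ‖x₀ − ℓ'(T)y'_n‖
for the whole sequence, such that (εθ)_n → 0 and with ℓ'_n(T)y'_n converging in norm. Then, for the limit
ℓ'_∞(T)y'_∞ we will have ⟨T^j ℓ'_∞(T)y'_∞, x₀ − ℓ'_∞(T)y'_∞⟩ = 0 for all j ≥ 0, i.e. (11) ℓ'_∞(T)y'_∞ is non-cyclic."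
Here `w n` stands for ℓ'_n(T) y'_n and the hypothesis `h` is (9): |⟨T^j ℓ'(T)y', x₀ − ℓ'(T)y'⟩| ≤ εθ for every j.
Dictionary: paper ⟨u, v⟩ (linear in u) = Mathlib `⟪v, u⟫_ℂ`.
STATUS: CLOSED (zero sorry).  This step FOLLOWS — given NORM convergence, which is exactly what the gap at
p.20 (after (46)) fails to deliver; see Gap.lean / GAP.md.
-/

open scoped InnerProductSpace
open Filter Topology

namespace Literature.Analysis.OperatorTheory.Enflo2023

variable {H : Type*} [NormedAddCommGroup H] [InnerProductSpace ℂ H]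

/-- v2 (11), core: norm limits of "(εθ)_n-almost non-cyclic" vectors have orbit orthogonal to `x₀ − wlim`. [cite: Enflo2023, v2 eq. (11), p.4] -/
theorem orbit_orthogonal_of_norm_limit (T : H →L[ℂ] H) (x₀ : H) (w : ℕ → H) (wlim : H) (ε : ℕ → ℝ)
    (hw : Tendsto w atTop (𝓝 wlim)) (hε : Tendsto ε atTop (𝓝 0))
    (h : ∀ n j, ‖⟪x₀ - w n, (T ^ j) (w n)⟫_ℂ‖ ≤ ε n) :
    ∀ j : ℕ, ⟪x₀ - wlim, (T ^ j) wlim⟫_ℂ = 0 := by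
  intro j
  have hcont : Continuous fun v : H => ⟪x₀ - v, (T ^ j) v⟫_ℂ :=
    Continuous.inner (continuous_const.sub continuous_id) (T ^ j).continuous
  have h1 : Tendsto (fun n => ⟪x₀ - w n, (T ^ j) (w n)⟫_ℂ) atTop (𝓝 ⟪x₀ - wlim, (T ^ j) wlim⟫_ℂ) :=
    (hcont.tendsto wlim).comp hw
  have h2 : Tendsto (fun n => ‖⟪x₀ - w n, (T ^ j) (w n)⟫_ℂ‖) atTop (𝓝 0) :=
    squeeze_zero (fun n => norm_nonneg _) (fun n => h n j) hε
  exact norm_eq_zero.mp (tendsto_nhds_unique h1.norm h2)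

omit [InnerProductSpace ℂ H] in
/-- If `‖x₀‖ = 1` and `‖x₀ - w‖ < 1` then `w ≠ 0`. (MC keeps `‖x₀ − ℓ'(T)y'‖ ≤ 0.7`.) [folklore] -/
lemma ne_zero_of_norm_sub_lt_one {x₀ w : H} (hx₀ : ‖x₀‖ = 1) (hw : ‖x₀ - w‖ < 1) : w ≠ 0 := by
  rintro rfl
  simp [hx₀] at hw

/-- v2 (11), full deduction: a norm-convergent MC output gives a non-trivial closed invariant subspace.
Hypotheses as the paper has them on p.4: `‖x₀‖ = 1`, `0.3 ≤ ‖x₀ − w n‖ ≤ 0.7` for all `n`, (9) with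
`(εθ)_n → 0`, and `w n → wlim` IN NORM. [cite: Enflo2023, v2 eq. (11), p.4] -/
theorem hasNontrivialClosedInvariantSubspace_of_norm_convergent_MC (T : H →L[ℂ] H) (x₀ : H)
    (w : ℕ → H) (wlim : H) (ε : ℕ → ℝ) (hx₀ : ‖x₀‖ = 1)
    (hdist : ∀ n, 0.3 ≤ ‖x₀ - w n‖ ∧ ‖x₀ - w n‖ ≤ 0.7)
    (hw : Tendsto w atTop (𝓝 wlim)) (hε : Tendsto ε atTop (𝓝 0))
    (h : ∀ n j, ‖⟪x₀ - w n, (T ^ j) (w n)⟫_ℂ‖ ≤ ε n) :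
    HasNontrivialClosedInvariantSubspace T := by
  have horth := orbit_orthogonal_of_norm_limit T x₀ w wlim ε hw hε h
  -- pass the distance bounds to the limit
  have hd : Tendsto (fun n => ‖x₀ - w n‖) atTop (𝓝 ‖x₀ - wlim‖) :=
    ((continuous_const.sub continuous_id).norm.tendsto wlim).comp hw
  have hle : ‖x₀ - wlim‖ ≤ 0.7 := le_of_tendsto' hd fun n => (hdist n).2
  have hge : (0.3 : ℝ) ≤ ‖x₀ - wlim‖ := ge_of_tendsto' hd fun n => (hdist n).1
  have hw0 : wlim ≠ 0 := ne_zero_of_norm_sub_lt_one hx₀ (by linarith)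
  have hx : x₀ - wlim ≠ 0 := by
    intro h0; rw [h0, norm_zero] at hge; linarith
  exact hasNontrivialClosedInvariantSubspace_of_orbit_orthogonal' T hw0 hx horth

end Literature.Analysis.OperatorTheory.Enflo2023
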